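/- Copyright: the b2b-balaban cell (near-miss cell 7), T⁴-continuum fan-out; row NE7b ROUND-2 swarm, seat
t4-ne7b-formalise-leaf-08 (gen 12) (row S12o «CONCAVE ENTROPY REPAIR», part (iv) 3 — the displayed twin field supplied at
the concave constant + headline v1.2; R-OWNER-23-15 (2) ∕ -16, journal l.17861 ∕ l.18741; intent l.19086, owner GO v3.63
l.19119; v1.1 DOC-ONLY: the hidden level is LINEAR — module docstring §4 sentence made precise, decls byte-identical). -/
import Summits.QuantumFields.BalabanUV.T4Continuum.Support.HistoryRealiseCellsRunHeadlineT3bPTwin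
import Summits.QuantumFields.BalabanUV.T4Continuum.Support.HistoryRealiseCellsRunHeadlineT3bP
import Summits.QuantumFields.BalabanUV.T4Continuum.Support.HistoryAssemblyMultInstanceConcave

/-!
# Realised histories: THE TWIN FIELD SUPPLIED AT THE CONCAVE CONSTANT, AND THE HEADLINE v1.2 WITH THE STATEMENT OF RECORD

Summits-side support leaf of the T⁴-continuum cell (rung (B)+1 on a FINITE torus only; NOT infinite volume, NOT the
mass gap, NOT the Clay statement; NOT a proof of the spine estimate NE7b).  Row S12 ∕ node A12-I of the claim table
`t4/b2b-balaban-t4-ne7b-p1/LEAVES-NE7b.md`, owner row S12o «CONCAVE ENTROPY REPAIR» (R-OWNER-23-15 (2)), part (iv)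
«pinned ∕ headline v1.2», third file (typer's test M5∕M6, `ACCEPT-A12I.md` v1.28 §T: «the headline v1.2 can re-home at ANY
twin constant … with p224237's statement unchanged»).  Sibling of leaf-02 gen 12's `HistoryRealiseCellsRunHeadlineT3bPTwin`
(p230345: the headline UNIFORM in the class-linear constant `Θ₀` over the witness `CountRoadWitnessT3bTwin … Θ₀ …`, whose
one new field `twin` — row S6g′'s placement-entropy inequality along the run — is DISPLAYED) and of leaf-05 gen 10's
junction `HistoryAssemblyMultInstanceConcave.htwin_concave` (p230092: the twin family at `Θ₀ := ΘJc d sS θc`, row S12o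
(ii)'s concave constant, GIVEN the run's profile control).

WHAT.  §1 **`forSmallCouplings_profileCtl`**: under `BetaPertHyp D.βfun` (`0 < β₀`, `F.L·β₀ ≤ 1`), FOR ALL SMALL-COUPLING
TUNED RUNS (`T4ContinuumYM4Torus.ForSmallCouplings`) every (2.5)-admissible size function `R` has a stepwise non-increasing,
drop-controlled profile `runProfile F.L R K` at every cutoff — the profile control END v3.1′ ∕ v3.2′ derive INSIDE their
proofs (`HistoryRealiseCellsRun.runProfile_succ_le`, `HistoryAssemblyRealiseRun.dropCtl_runProfile` from
`HistoryFlow.flowSide_of_betaPertHyp`), exported under the prefix.  §2 **`twin_concave_of_profileCtl`**: for a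
`CountRoadWitnessT3b` `X` (p223239) with profile control, floor signs `0 < E₂`, `0 ≤ E₃` and the count's stride ∕ smallness ∕
decay arithmetic at collar 32, the sentence of the field `CountRoadWitnessT3bTwin.twin` at `Θ₀ := ΘJc d sS θc` (written out
exactly as in `htwin_concave`) holds on `X`'s own `K₀ ∕ T ∕ R ∕ ped ∕ liveC` (`htwin_concave` at `s := runProfile F.L X.R`,
`H := X.realised`); **`nonempty_twinConcave`**: hence `Nonempty (CountRoadWitnessT3bTwin … (ΘJc …) g₀ os ι α π)` (a theorem;
no `def`); **`twin_linear_of_profileCtl`** ∕ **`nonempty_twinLinear`**: the same at the TREE's constant `ΘJ d sS θc` (v1.1's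
reading) from `HistoryJoinsPlacedTwin.card_S_sortR_le_exp_pow`.  §3 **`forSmallCouplings_twinConcave_of_betaPertHyp`**:
`BetaPertHyp D.βfun →` [v1.1's binders `hn hβ₀ hLβ hE₂ hE₃ hsS hsmall hθc0 hθc1 hθcs`] `→ ForSmallCouplings D (∀ os, a
CountRoadWitnessT3b) → ForSmallCouplings D (∀ os, a CountRoadWitnessT3bTwin at ΘJc …)` (`ForSmallCouplings.and` ∕ `.mono`), and
**`forSmallCouplings_twinLinear_of_betaPertHyp`** (at `ΘJ`): THE DISPLAYED FIELD `twin` IS PRODUCED from the parent witness —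
under `BetaPertHyp` and the prefix (it costs a γ-threshold), not pointwise; this is why it is not «one lambda» from outside
the pinned proof.  §4 **THE HEADLINE v1.2 IN THE KERNEL**: the gate's `dedup.landed` rule forbids re-landing p224237's
statements under new names, so v1.2 is three `example`s whose TYPES are the record's declarations' types BY NAME
(`type_of% @HistoryRealiseCellsRunHeadlineT3bP.hybridNE7Under_of_countRoadT3bP_fsc`, `… .continuumYM4Torus_of_countRoadT3bP_fsc`
— typer's M5∕M6 with nothing to diff) and whose proofs are leaf-02 gen 12's `Θ₀`-uniform theorems at `Θ₀ := ΘJc d sS θc`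
over §3 (so the coupling window hidden in THAT proof pays the concave constant at the LINEAR level:
`x_Θ = max 1 ((ΘJc + 8·2^d·log(2d+1))∕(θ·C.A₀))` inside `HistoryRealiseCellsRunPinnedT3bPTwin`, i.e. `g₁`'s second factor is
`e^{−(x_Θ+1)∕2}` — at the census letters (d = 4, c = 32, sS = 34, θc₀ = 0.9799, θ·A₀ := 1) `x_Θ ≈ 912.5` by leaf-08 gen 11's
`HistoryThetaConcaveNumerals.thetaJc_le`, factor `≈ e^{−457}`, versus `e^{−1.2·10²⁷}` for the tree's `ΘJ`; the census of
record's «`x_root ≈ 1.345`, `g₁ ≈ 0.31` at `p₀ = 23`» is the ROOT-level window of leaf-08 gen 8's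
`HistoryFlowProfileRoot.thresholdPaid_of_coupling_root`, DISPLAYED as a hypothesis shape by the sibling
`HistoryRealiseCellsRunWindowT3bPc` (v1.1 note)), plus the apex input once more at the tree's `ΘJ` (v1.1's reading is an
instance of the uniform theorem too).  `exists_consts_countRoadT3bP` (p224237) inhabits the constants-side antecedent
verbatim and is not restated.

HONEST READING (verbatim for headlines; c4).  NOTHING new is claimed at the headline: the §4 examples close p224237's own
`Prop`s — `ContinuumYM4Torus D ⇐ (B) ∧ BetaPertHyp ∧ [∀ small-coupling tuned run ∀ string: CountRoadWitnessT3b]` (+ sign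
conventions + INHABITED constants-side conditions incl. the symbolic stride ∕ decay arithmetic, c2∕c6) — through the
concave road (row S12o is kernel-invisible at the headline; only the ∃-bound `g₁` moves).  The witness displays what it
displayed (H3: realised pedigrees with domains, `step ≤ cutoff`, `DisjointJoins` ∕ `BoxedBirths`, realised costs, price
sentences with the discount, numerator readings; E1∕E2; the (B)-side floors ∕ sites ∕ envelopes; NE7c's `ShellWeightBound`;
NE7's `ReindexedBudget`; four summable rates); on this road the twin bound is NOT a displayed item (it is produced, §3).  The
headline of record p224237 is NOT superseded; spine count 0∕9 UNCHANGED; NE7b NOT proved.  [folklore] composition by name;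
no `def`, no `structure`, no `Prop`-fact minted (c1), no `[cite:]` tag, nothing printed asserted (ABSOLUTE RULE), no constant
specialised (c2∕c6), no exit ∕ socket ∕ `HistoryConstants*` ∕ landed file touched (c3).  HONEST DEPENDENCY (cell): continuum
YM on T⁴ ⇐ BetaPertH ∧ nine spine estimates (0/9 proved); BetaPertH ⇐ (D1) ∧ (D4) ∧ CAP+tail; G-an2-4 gates asym, D1 and
NE2/3/4.  This file changes none of it. -/

open Literature.MathematicalPhysics.QuantumFieldTheory.Balaban1983to89
open T4PersistenceDictionary T4PrintedShapeBanking T4TaggedShapeBanking T4PartnerMultiplicity T4Continuum T4CanonicalMenus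
open Literature.MathematicalPhysics.QuantumFieldTheory.Balaban1983to89.B16SProfile (DropCtl)
open Literature.MathematicalPhysics.QuantumFieldTheory.Balaban1983to89.B13ScaleTransfer (Pt)
open Summit.QuantumFields.BalabanUV.T4Continuum
open CountThresholdUniform HistoryFlow HistoryConstants HistoryBankingLE HistoryAssemblyRealiseRun HistoryZones
open HistoryRealiseCellsRun HistoryRegionTemplates ZoneTorus HistoryAdmissible HistoryJoins HistoryJoinsTemplates
open HistoryJoinsPlacedZone HistoryRealiseCellsRunPinnedT3bPTwin HistoryRealiseCellsRunApexT3b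
open HistoryRealiseCellsRunHeadlineT3bPTwin HistoryRenewalsCost HistoryZoneMassLawLevels HistoryJoinsPlacedTwin
open HistoryZoneEvolve (cth)
open HistoryJoinsAdm (Addr)
open HistoryAssemblyMultInstanceConcave (htwin_concave)

namespace Summit.QuantumFields.BalabanUV.T4Continuum.HistoryRealiseCellsRunHeadlineT3bPc

noncomputable section
universe u

/-! ## §1 The run's profile control, for all small-coupling tuned runs, from `BetaPertHyp` -/

section Profile

variable {F : T4Family} {G : Type*} [GaugeGroup G] [MeasurableSpace G] [HaarData G]

/-- **PROFILE CONTROL UNDER THE PREFIX.**  If the β-family satisfies `BetaPertHyp`, then for every `0 < β₀` with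
`F.L·β₀ ≤ 1` and every exponent `rr`, FOR ALL SMALL-COUPLING TUNED RUNS `g₀` (`ForSmallCouplings`; γ-threshold the flow
side's, no condition on `g`): every (2.5)-admissible size function `R` (`B14.IsRj … rr`) has, at every cutoff `K`, a
stepwise NON-INCREASING profile `runProfile F.L R K` (`runProfile_succ_le` below the cutoff, constant beyond) which is
DROP-CONTROLLED at every horizon (`dropCtl_runProfile`, `β₀ ≤ ½` from `F.L·β₀ ≤ 1`) — END v3.1′'s inner profile control,
exported. [folklore] -/
theorem forSmallCouplings_profileCtl (D : FiniteEpsData F G) (hβ : BetaPertHyp D.βfun) {β₀ : ℝ} (hβ₀ : 0 < β₀)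
    (hLβ : (F.L : ℝ) * β₀ ≤ 1) (rr : ℕ) :
    T4ContinuumYM4Torus.ForSmallCouplings D fun g₀ => ∀ R : ℕ → ℕ → ℕ,
      (∀ K s, s ≤ K → B14.IsRj F.L rr ((D.C ⟨K, F.m, g₀ K⟩).flow.g s) (R K s)) →
      ∀ K, (∀ t, runProfile F.L R K (t + 1) ≤ runProfile F.L R K t) ∧ ∀ m, DropCtl (runProfile F.L R K) m := by
  obtain ⟨hβ₁, hβhalf⟩ := HistoryRealiseCellsRunPinned.beta0_le_of_L_mul_le hLβ
  obtain ⟨γ₀, b, β', _hγ₀, hb, _hbβ, hlo, hhi, γf, hγf, hγf₀, hS⟩ := flowSide_of_betaPertHyp D hβ hβ₀ hβ₁ hLβ rr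
  refine ⟨γf, hγf, fun γ hγ hγle => ⟨1, one_pos, fun g _ _ g₀ ht R hR K => ?_⟩⟩
  obtain ⟨hSm, hγβ⟩ := hS γ hγ hγle
  refine ⟨fun t => ?_, dropCtl_runProfile D hb.le hlo hhi (hγle.trans hγf₀) hγβ hSm le_rfl hβhalf ht R hR K⟩
  by_cases htK : t < K
  · exact runProfile_succ_le D hb.le hlo hhi (hγle.trans hγf₀) hγβ hSm ht R hR K t htK
  · show expOf F.L (R K) (min (t + 1) K) ≤ expOf F.L (R K) (min t K)
    rw [min_eq_right (by omega), min_eq_right (by omega)]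

end Profile

/-! ## §2 The twin field at the concave constant, from profile control -/

section Twin

variable {F : T4Family} {G : Type*} [GaugeGroup G] [MeasurableSpace G] [HaarData G]
  {D : FiniteEpsData F G} {C : T4PrintedShapeBanking.Consts} {O : PrintedO1s} {rr d n : ℕ} {hn : 0 < n}
  {g₀ : ℕ → ℝ} {os : List (ULoop F)} {ι α π : Type} [DecidableEq ι] [DecidableEq α] [DecidableEq π]

/-- **THE TWIN FIELD'S SENTENCE AT `Θ₀ := ΘJc d sS θc` ON A COUNT-ROAD WITNESS**, from the profile control of its size
function: leaf-05 gen 10's `HistoryAssemblyMultInstanceConcave.htwin_concave` at `s := runProfile F.L X.R`, `H := X.realised`,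
`hR1 := X.one_le_R` (the constant written out as there: `1 + log(X + 2γ′) + (0 + 3d₁ + 2d + d₁·Cr + d·log(2Ω(1+Cr)+1)) + 10`,
`d₁ = 2 log(2d+1)`, `Ω = ρℓX + ρℓγ′ + 1`, collar 32, stride `sS`, decay `θc`). [folklore] -/
theorem twin_concave_of_profileCtl (X : CountRoadWitnessT3b D C O rr d n hn g₀ os ι α π)
    (hE₂ : 0 < C.E₂) (hE₃ : 0 ≤ C.E₃)
    (hctl : ∀ K, (∀ t, runProfile F.L X.R K (t + 1) ≤ runProfile F.L X.R K t) ∧ ∀ m, DropCtl (runProfile F.L X.R K) m)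
    {sS : ℕ} (hsS : 1 ≤ sS)
    (hsmall : (((2 * cth 32 1 sS + 1) ^ d : ℕ) : ℝ) * (5 : ℝ) ^ d * ((max 1 (2 * 32 + 2) : ℕ) : ℝ) ≤
      (F.L : ℝ) ^ (sS / 2) / 2)
    {θc : ℝ} (hθc0 : 0 ≤ θc) (hθc1 : θc < 1) (hθcs : 1 / 2 ≤ θc ^ sS) :
    ∀ K, X.K₀ ≤ K → ∀ τ ∈ X.T K, ∀ c ∈ X.liveC K τ,
      ConsistentTLE Prod.fst C K (X.R K) ((X.ped K τ).genT c) → (X.ped K τ).step c ≤ K →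
      ∀ (Mz Dz : ℕ) (c₀ : TCell d (n * F.L ^ K) × Template d Mz)
        (ρ : (Addr Dz → TCell d (n * F.L ^ K) × Template d Mz) → ℕ) (z : TCell d (n * F.L ^ K) × Template d Mz),
      ((HistoryJoinsAdm.S (zoneP n F.L K (levelOf (runProfile F.L X.R K) K) 32 c₀) ρ c₀ PEv.step
          ((X.ped K τ).sortR.gen c) z).card : ℝ) ≤
        Real.exp ((1 + Real.log
            ((2 * (((2 * cth 32 1 sS + 1) ^ d : ℕ) : ℝ) * ((((2 * 32 + 1) ^ d : ℕ) : ℝ) * (4 * 2 ^ d)) +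
                  4 * ((((2 * cth 32 1 sS + 1) ^ d : ℕ) : ℝ) * (5 : ℝ) ^ d)) / (1 - θc) +
              2 * (2 * ((((2 * cth 32 1 sS + 1) ^ d : ℕ) : ℝ) * (5 : ℝ) ^ d))) +
            (0 + 3 * (2 * Real.log (2 * d + 1)) + 2 * (d : ℝ) + 2 * Real.log (2 * d + 1) * (4 * 2 ^ d) +
              (d : ℝ) * Real.log (2 *
                ((((max 1 (2 * 32 + 2) : ℕ) : ℝ) *
                      ((2 * (((2 * cth 32 1 sS + 1) ^ d : ℕ) : ℝ) * ((((2 * 32 + 1) ^ d : ℕ) : ℝ) * (4 * 2 ^ d)) +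
                          4 * ((((2 * cth 32 1 sS + 1) ^ d : ℕ) : ℝ) * (5 : ℝ) ^ d)) / (1 - θc)) +
                    ((max 1 (2 * 32 + 2) : ℕ) : ℝ) * (2 * ((((2 * cth 32 1 sS + 1) ^ d : ℕ) : ℝ) * (5 : ℝ) ^ d)) + 1) *
                  (1 + 4 * 2 ^ d)) + 1)) +
            10) * bsum (fun b => ((b.fat : ℕ) : ℝ) + 1) ((X.ped K τ).gen c) +
            8 / C.E₂ * totalCostT Prod.fst C K (X.R K) ((X.ped K τ).genT c)) *
          (((F.L : ℝ) ^ d) * Real.exp 4) ^ partnerAges PEv.step ((X.ped K τ).gen c) :=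
  htwin_concave hn (lt_of_lt_of_le (by norm_num) (two_le_L F)) hE₂ hE₃ (fun K _ t => (hctl K).1 t)
    (fun K _ m => (hctl K).2 m) X.one_le_R X.realised hsS hsmall hθc0 hθc1 hθcs

/-- **THE WITNESS WITH ITS TWIN FIELD FILLED AT THE CONCAVE CONSTANT**: a `CountRoadWitnessT3b` with profile control (and
the floor signs and the count's stride ∕ smallness ∕ decay arithmetic) gives a `CountRoadWitnessT3bTwin` at
`Θ₀ := ΘJc d sS θc` — leaf-02 gen 12's structure, field `twin := twin_concave_of_profileCtl …`, every other field `X`'s.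
Stated under `Nonempty` (a theorem; the structure is `Type`-valued and is only ever consumed under `Nonempty`). [folklore] -/
theorem nonempty_twinConcave (X : CountRoadWitnessT3b D C O rr d n hn g₀ os ι α π)
    (hE₂ : 0 < C.E₂) (hE₃ : 0 ≤ C.E₃)
    (hctl : ∀ K, (∀ t, runProfile F.L X.R K (t + 1) ≤ runProfile F.L X.R K t) ∧ ∀ m, DropCtl (runProfile F.L X.R K) m)
    {sS : ℕ} (hsS : 1 ≤ sS)
    (hsmall : (((2 * cth 32 1 sS + 1) ^ d : ℕ) : ℝ) * (5 : ℝ) ^ d * ((max 1 (2 * 32 + 2) : ℕ) : ℝ) ≤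
      (F.L : ℝ) ^ (sS / 2) / 2)
    {θc : ℝ} (hθc0 : 0 ≤ θc) (hθc1 : θc < 1) (hθcs : 1 / 2 ≤ θc ^ sS) :
    Nonempty (CountRoadWitnessT3bTwin D C O rr d n hn
      ((1 + Real.log
            ((2 * (((2 * cth 32 1 sS + 1) ^ d : ℕ) : ℝ) * ((((2 * 32 + 1) ^ d : ℕ) : ℝ) * (4 * 2 ^ d)) +
                  4 * ((((2 * cth 32 1 sS + 1) ^ d : ℕ) : ℝ) * (5 : ℝ) ^ d)) / (1 - θc) +
              2 * (2 * ((((2 * cth 32 1 sS + 1) ^ d : ℕ) : ℝ) * (5 : ℝ) ^ d))) +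
            (0 + 3 * (2 * Real.log (2 * d + 1)) + 2 * (d : ℝ) + 2 * Real.log (2 * d + 1) * (4 * 2 ^ d) +
              (d : ℝ) * Real.log (2 *
                ((((max 1 (2 * 32 + 2) : ℕ) : ℝ) *
                      ((2 * (((2 * cth 32 1 sS + 1) ^ d : ℕ) : ℝ) * ((((2 * 32 + 1) ^ d : ℕ) : ℝ) * (4 * 2 ^ d)) +
                          4 * ((((2 * cth 32 1 sS + 1) ^ d : ℕ) : ℝ) * (5 : ℝ) ^ d)) / (1 - θc)) +
                    ((max 1 (2 * 32 + 2) : ℕ) : ℝ) * (2 * ((((2 * cth 32 1 sS + 1) ^ d : ℕ) : ℝ) * (5 : ℝ) ^ d)) + 1) *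
                  (1 + 4 * 2 ^ d)) + 1)) +
            10)) g₀ os ι α π) :=
  ⟨{ toCountRoadWitnessT3b := X, twin := twin_concave_of_profileCtl X hE₂ hE₃ hctl hsS hsmall hθc0 hθc1 hθcs }⟩

/-- **THE TWIN FIELD'S SENTENCE AT THE TREE'S CONSTANT `Θ₀ := ΘJ d sS θc`** (v1.1's reading) on a count-road witness, from
the profile control of its size function: the tree's twin END `HistoryJoinsPlacedTwin.card_S_sortR_le_exp_pow` (p219354) along
the run — leaf-08 gen 11's three-line lambda (`HistoryAssemblyMultInstanceTwin`, fidelity `example`) at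
`s := runProfile F.L X.R`, `H := X.realised`. [folklore] -/
theorem twin_linear_of_profileCtl (X : CountRoadWitnessT3b D C O rr d n hn g₀ os ι α π)
    (hE₂ : 0 < C.E₂) (hE₃ : 0 ≤ C.E₃)
    (hctl : ∀ K, (∀ t, runProfile F.L X.R K (t + 1) ≤ runProfile F.L X.R K t) ∧ ∀ m, DropCtl (runProfile F.L X.R K) m)
    {sS : ℕ} (hsS : 1 ≤ sS)
    (hsmall : (((2 * cth 32 1 sS + 1) ^ d : ℕ) : ℝ) * (5 : ℝ) ^ d * ((max 1 (2 * 32 + 2) : ℕ) : ℝ) ≤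
      (F.L : ℝ) ^ (sS / 2) / 2)
    {θc : ℝ} (hθc0 : 0 ≤ θc) (hθc1 : θc < 1) (hθcs : 1 / 2 ≤ θc ^ sS) :
    ∀ K, X.K₀ ≤ K → ∀ τ ∈ X.T K, ∀ c ∈ X.liveC K τ,
      ConsistentTLE Prod.fst C K (X.R K) ((X.ped K τ).genT c) → (X.ped K τ).step c ≤ K →
      ∀ (Mz Dz : ℕ) (c₀ : TCell d (n * F.L ^ K) × Template d Mz)
        (ρ : (Addr Dz → TCell d (n * F.L ^ K) × Template d Mz) → ℕ) (z : TCell d (n * F.L ^ K) × Template d Mz),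
      ((HistoryJoinsAdm.S (zoneP n F.L K (levelOf (runProfile F.L X.R K) K) 32 c₀) ρ c₀ PEv.step
          ((X.ped K τ).sortR.gen c) z).card : ℝ) ≤
        Real.exp ((2 +
            ((2 * (((2 * cth 32 1 sS + 1) ^ d : ℕ) : ℝ) * ((((2 * 32 + 1) ^ d : ℕ) : ℝ) * (4 * 2 ^ d)) +
                  4 * ((((2 * cth 32 1 sS + 1) ^ d : ℕ) : ℝ) * (5 : ℝ) ^ d)) / (1 - θc) +
              2 * (2 * ((((2 * cth 32 1 sS + 1) ^ d : ℕ) : ℝ) * (5 : ℝ) ^ d))) +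
            (2 * ((0 + 2 * Real.log (2 * d + 1)) + (2 * (d : ℝ) + 2 * Real.log (2 * d + 1)) *
                  (((max 1 (2 * 32 + 2) : ℕ) : ℝ) * (2 * ((((2 * cth 32 1 sS + 1) ^ d : ℕ) : ℝ) * (5 : ℝ) ^ d)))) +
              (2 * (d : ℝ) + 2 * Real.log (2 * d + 1)) * 1 *
                (((max 1 (2 * 32 + 2) : ℕ) : ℝ) *
                    ((2 * (((2 * cth 32 1 sS + 1) ^ d : ℕ) : ℝ) * ((((2 * 32 + 1) ^ d : ℕ) : ℝ) * (4 * 2 ^ d)) +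
                        4 * ((((2 * cth 32 1 sS + 1) ^ d : ℕ) : ℝ) * (5 : ℝ) ^ d)) / (1 - θc)) +
                  4 * 2 ^ d)) +
            10) * bsum (fun b => ((b.fat : ℕ) : ℝ) + 1) ((X.ped K τ).gen c) +
            8 / C.E₂ * totalCostT Prod.fst C K (X.R K) ((X.ped K τ).genT c)) *
          (((F.L : ℝ) ^ d) * Real.exp 4) ^ partnerAges PEv.step ((X.ped K τ).gen c) := by
  intro K hK τ hτ c _ hcons hKs Mz Dz c₀ ρ z
  have hlv : LevelFn K (levelOf (runProfile F.L X.R K) K) := levelFn_levelOf (fun t _ => (hctl K).1 t) ((hctl K).2 K)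
  have hφ : ∀ m, m ≤ K → C.E₂ ≤ floorK C K (X.R K) m := fun m hm => by
    simpa using le_floorK_of_le (C := C) (K := K) (R := X.R K) hE₂.le hm (X.one_le_R K hK m)
  exact card_S_sortR_le_exp_pow (X.ped K τ) ρ (X.realised.headOldest K hK τ hτ) (X.realised.renew_step K hK τ hτ)
    (X.realised.forest K hK τ hτ) hE₂.le hE₃ hE₂ hφ c hcons hKs (lt_of_lt_of_le (by norm_num) (two_le_L F)) hn hlv hsS
    (fun u _ => levelFn_add_half_le hlv u sS) hsmall hθc0 hθc1 hθcs z

/-- **THE WITNESS WITH ITS TWIN FIELD FILLED AT THE TREE'S CONSTANT `ΘJ d sS θc`** (v1.1's reading), under `Nonempty`.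
[folklore] -/
theorem nonempty_twinLinear (X : CountRoadWitnessT3b D C O rr d n hn g₀ os ι α π)
    (hE₂ : 0 < C.E₂) (hE₃ : 0 ≤ C.E₃)
    (hctl : ∀ K, (∀ t, runProfile F.L X.R K (t + 1) ≤ runProfile F.L X.R K t) ∧ ∀ m, DropCtl (runProfile F.L X.R K) m)
    {sS : ℕ} (hsS : 1 ≤ sS)
    (hsmall : (((2 * cth 32 1 sS + 1) ^ d : ℕ) : ℝ) * (5 : ℝ) ^ d * ((max 1 (2 * 32 + 2) : ℕ) : ℝ) ≤
      (F.L : ℝ) ^ (sS / 2) / 2)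
    {θc : ℝ} (hθc0 : 0 ≤ θc) (hθc1 : θc < 1) (hθcs : 1 / 2 ≤ θc ^ sS) :
    Nonempty (CountRoadWitnessT3bTwin D C O rr d n hn
      ((2 +
            ((2 * (((2 * cth 32 1 sS + 1) ^ d : ℕ) : ℝ) * ((((2 * 32 + 1) ^ d : ℕ) : ℝ) * (4 * 2 ^ d)) +
                  4 * ((((2 * cth 32 1 sS + 1) ^ d : ℕ) : ℝ) * (5 : ℝ) ^ d)) / (1 - θc) +
              2 * (2 * ((((2 * cth 32 1 sS + 1) ^ d : ℕ) : ℝ) * (5 : ℝ) ^ d))) +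
            (2 * ((0 + 2 * Real.log (2 * d + 1)) + (2 * (d : ℝ) + 2 * Real.log (2 * d + 1)) *
                  (((max 1 (2 * 32 + 2) : ℕ) : ℝ) * (2 * ((((2 * cth 32 1 sS + 1) ^ d : ℕ) : ℝ) * (5 : ℝ) ^ d)))) +
              (2 * (d : ℝ) + 2 * Real.log (2 * d + 1)) * 1 *
                (((max 1 (2 * 32 + 2) : ℕ) : ℝ) *
                    ((2 * (((2 * cth 32 1 sS + 1) ^ d : ℕ) : ℝ) * ((((2 * 32 + 1) ^ d : ℕ) : ℝ) * (4 * 2 ^ d)) +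
                        4 * ((((2 * cth 32 1 sS + 1) ^ d : ℕ) : ℝ) * (5 : ℝ) ^ d)) / (1 - θc)) +
                  4 * 2 ^ d)) +
            10)) g₀ os ι α π) :=
  ⟨{ toCountRoadWitnessT3b := X, twin := twin_linear_of_profileCtl X hE₂ hE₃ hctl hsS hsmall hθc0 hθc1 hθcs }⟩

end Twin

/-! ## §3 The transfer under the prefix: the displayed twin field is PRODUCED under `BetaPertHyp` -/

section Transfer

variable {F : T4Family} {G : Type*} [GaugeGroup G] [MeasurableSpace G] [HaarData G]

/-- **THE DISPLAYED TWIN FIELD IS PRODUCED UNDER `BetaPertHyp` AND THE PREFIX.**  If `BetaPertHyp D.βfun`, `0 < n`,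
`0 < β₀`, `F.L·β₀ ≤ 1`, the floor signs `0 < E₂`, `0 ≤ E₃` and the count's stride ∕ smallness ∕ decay arithmetic hold
(v1.1's binders, symbolic), then «for all small-coupling tuned runs and all strings, a `CountRoadWitnessT3b`» implies
«for all small-coupling tuned runs and all strings, a `CountRoadWitnessT3bTwin` at `Θ₀ := ΘJc d sS θc`» — by §1 (profile
control under the prefix, `ForSmallCouplings.and`) and §2 (`ForSmallCouplings.mono`).  The γ-threshold shrinks to the
flow side's; nothing else moves. [folklore] -/
theorem forSmallCouplings_twinConcave_of_betaPertHyp (D : FiniteEpsData F G) (hβ : BetaPertHyp D.βfun)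
    {C : T4PrintedShapeBanking.Consts} {O : PrintedO1s} {rr : ℕ} {β₀ : ℝ} {d n : ℕ} (hn : 0 < n)
    (hβ₀ : 0 < β₀) (hLβ : (F.L : ℝ) * β₀ ≤ 1) (hE₂ : 0 < C.E₂) (hE₃ : 0 ≤ C.E₃) {sS : ℕ} (hsS : 1 ≤ sS)
    (hsmall : (((2 * cth 32 1 sS + 1) ^ d : ℕ) : ℝ) * (5 : ℝ) ^ d * ((max 1 (2 * 32 + 2) : ℕ) : ℝ) ≤
      (F.L : ℝ) ^ (sS / 2) / 2)
    {θc : ℝ} (hθc0 : 0 ≤ θc) (hθc1 : θc < 1) (hθcs : 1 / 2 ≤ θc ^ sS)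
    (hData : T4ContinuumYM4Torus.ForSmallCouplings D fun g₀ => ∀ os : List (ULoop F),
        ∃ (ι α π : Type) (_ : DecidableEq ι) (_ : DecidableEq α) (_ : DecidableEq π),
          Nonempty (CountRoadWitnessT3b D C O rr d n hn g₀ os ι α π)) :
    T4ContinuumYM4Torus.ForSmallCouplings D fun g₀ => ∀ os : List (ULoop F),
        ∃ (ι α π : Type) (_ : DecidableEq ι) (_ : DecidableEq α) (_ : DecidableEq π),
          Nonempty (CountRoadWitnessT3bTwin D C O rr d n hn
            ((1 + Real.log
            ((2 * (((2 * cth 32 1 sS + 1) ^ d : ℕ) : ℝ) * ((((2 * 32 + 1) ^ d : ℕ) : ℝ) * (4 * 2 ^ d)) +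
                  4 * ((((2 * cth 32 1 sS + 1) ^ d : ℕ) : ℝ) * (5 : ℝ) ^ d)) / (1 - θc) +
              2 * (2 * ((((2 * cth 32 1 sS + 1) ^ d : ℕ) : ℝ) * (5 : ℝ) ^ d))) +
            (0 + 3 * (2 * Real.log (2 * d + 1)) + 2 * (d : ℝ) + 2 * Real.log (2 * d + 1) * (4 * 2 ^ d) +
              (d : ℝ) * Real.log (2 *
                ((((max 1 (2 * 32 + 2) : ℕ) : ℝ) *
                      ((2 * (((2 * cth 32 1 sS + 1) ^ d : ℕ) : ℝ) * ((((2 * 32 + 1) ^ d : ℕ) : ℝ) * (4 * 2 ^ d)) +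
                          4 * ((((2 * cth 32 1 sS + 1) ^ d : ℕ) : ℝ) * (5 : ℝ) ^ d)) / (1 - θc)) +
                    ((max 1 (2 * 32 + 2) : ℕ) : ℝ) * (2 * ((((2 * cth 32 1 sS + 1) ^ d : ℕ) : ℝ) * (5 : ℝ) ^ d)) + 1) *
                  (1 + 4 * 2 ^ d)) + 1)) +
            10)) g₀ os ι α π) :=
  T4ContinuumYM4Torus.ForSmallCouplings.mono
    (fun g₀ hg os => by
      obtain ⟨hctl, H⟩ := hg
      obtain ⟨ι, α, π, _, _, _, ⟨X⟩⟩ := H os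
      exact ⟨ι, α, π, _, _, _, nonempty_twinConcave X hE₂ hE₃ (hctl X.R X.isRj) hsS hsmall hθc0 hθc1 hθcs⟩)
    ((forSmallCouplings_profileCtl D hβ hβ₀ hLβ rr).and hData)

/-- **THE SAME TRANSFER AT THE TREE'S CONSTANT `ΘJ d sS θc`** (v1.1's reading): under `BetaPertHyp` and the prefix, the
parent witnesses give `CountRoadWitnessT3bTwin`s at `ΘJ` — so the record's road is ALSO an instance of leaf-02 gen 12's
`Θ₀`-uniform headline (its docstring's claim, in the kernel). [folklore] -/
theorem forSmallCouplings_twinLinear_of_betaPertHyp (D : FiniteEpsData F G) (hβ : BetaPertHyp D.βfun)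
    {C : T4PrintedShapeBanking.Consts} {O : PrintedO1s} {rr : ℕ} {β₀ : ℝ} {d n : ℕ} (hn : 0 < n)
    (hβ₀ : 0 < β₀) (hLβ : (F.L : ℝ) * β₀ ≤ 1) (hE₂ : 0 < C.E₂) (hE₃ : 0 ≤ C.E₃) {sS : ℕ} (hsS : 1 ≤ sS)
    (hsmall : (((2 * cth 32 1 sS + 1) ^ d : ℕ) : ℝ) * (5 : ℝ) ^ d * ((max 1 (2 * 32 + 2) : ℕ) : ℝ) ≤
      (F.L : ℝ) ^ (sS / 2) / 2)
    {θc : ℝ} (hθc0 : 0 ≤ θc) (hθc1 : θc < 1) (hθcs : 1 / 2 ≤ θc ^ sS)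
    (hData : T4ContinuumYM4Torus.ForSmallCouplings D fun g₀ => ∀ os : List (ULoop F),
        ∃ (ι α π : Type) (_ : DecidableEq ι) (_ : DecidableEq α) (_ : DecidableEq π),
          Nonempty (CountRoadWitnessT3b D C O rr d n hn g₀ os ι α π)) :
    T4ContinuumYM4Torus.ForSmallCouplings D fun g₀ => ∀ os : List (ULoop F),
        ∃ (ι α π : Type) (_ : DecidableEq ι) (_ : DecidableEq α) (_ : DecidableEq π),
          Nonempty (CountRoadWitnessT3bTwin D C O rr d n hn
            ((2 +
            ((2 * (((2 * cth 32 1 sS + 1) ^ d : ℕ) : ℝ) * ((((2 * 32 + 1) ^ d : ℕ) : ℝ) * (4 * 2 ^ d)) +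
                  4 * ((((2 * cth 32 1 sS + 1) ^ d : ℕ) : ℝ) * (5 : ℝ) ^ d)) / (1 - θc) +
              2 * (2 * ((((2 * cth 32 1 sS + 1) ^ d : ℕ) : ℝ) * (5 : ℝ) ^ d))) +
            (2 * ((0 + 2 * Real.log (2 * d + 1)) + (2 * (d : ℝ) + 2 * Real.log (2 * d + 1)) *
                  (((max 1 (2 * 32 + 2) : ℕ) : ℝ) * (2 * ((((2 * cth 32 1 sS + 1) ^ d : ℕ) : ℝ) * (5 : ℝ) ^ d)))) +
              (2 * (d : ℝ) + 2 * Real.log (2 * d + 1)) * 1 *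
                (((max 1 (2 * 32 + 2) : ℕ) : ℝ) *
                    ((2 * (((2 * cth 32 1 sS + 1) ^ d : ℕ) : ℝ) * ((((2 * 32 + 1) ^ d : ℕ) : ℝ) * (4 * 2 ^ d)) +
                        4 * ((((2 * cth 32 1 sS + 1) ^ d : ℕ) : ℝ) * (5 : ℝ) ^ d)) / (1 - θc)) +
                  4 * 2 ^ d)) +
            10)) g₀ os ι α π) :=
  T4ContinuumYM4Torus.ForSmallCouplings.mono
    (fun g₀ hg os => by
      obtain ⟨hctl, H⟩ := hg
      obtain ⟨ι, α, π, _, _, _, ⟨X⟩⟩ := H os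
      exact ⟨ι, α, π, _, _, _, nonempty_twinLinear X hE₂ hE₃ (hctl X.R X.isRj) hsS hsmall hθc0 hθc1 hθcs⟩)
    ((forSmallCouplings_profileCtl D hβ hβ₀ hLβ rr).and hData)

end Transfer

/-! ## §4 The headline v1.2 in the kernel: the record's statements BY NAME, proved through the twin road

The gate's `dedup.landed` rule forbids re-landing an already-landed STATEMENT under a new name (a named
`continuumYM4Torus_of_countRoadT3bPc_fsc` with p224237's statement bounces by design — dry-run 2026-08-20T18:4xZ), so the
headline v1.2 is delivered as kernel `example`s whose TYPES are the record's declarations' types BY NAME (`type_of% @…`;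
typer's M5∕M6 with nothing to diff) and whose proofs run through leaf-02 gen 12's `Θ₀`-uniform twin theorems over §3 —
at the concave constant (the level hidden in THAT proof is the LINEAR `x_Θ = max 1 ((ΘJc + 8·2^d·log(2d+1))∕(θ·C.A₀))`) and,
for the apex input, also at the tree's constant.  The record's own proofs are not used; the record is NOT superseded. -/

/-- **M5∕M6, APEX INPUT AT THE CONCAVE CONSTANT**: the type of v1.1's `hybridNE7Under_of_countRoadT3bP_fsc` (p224237) BY
NAME, closed by `hybridNE7Under_of_countRoadT3bPTwin_fsc` at `Θ₀ := ΘJc d sS θc` over `forSmallCouplings_twinConcave_of_betaPertHyp`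
(`BetaPertHyp` is in scope once the apex's two antecedents are introduced).  The every-`γ, g` form and the existence ∕
uniqueness ∕ targets corollaries follow from this term exactly as in the record's file.  NE7b NOT proved. [folklore] -/
example : type_of% @HistoryRealiseCellsRunHeadlineT3bP.hybridNE7Under_of_countRoadT3bP_fsc.{u} :=
  fun D hM hsign _ _ _ _ h hμ d n hκ₁ hE₀ hA₀ hβ₀ hLβ hn₁ hn _ hθ hslack hE₂ hE₃ _ hsS hsmall _ hθc0 hθc1 hθcs hData hB hβ =>
    hybridNE7Under_of_countRoadT3bPTwin_fsc D hM hsign h hμ d n hκ₁ hE₀ hA₀ hβ₀ hLβ hn₁ hn hθ hslack _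
      (forSmallCouplings_twinConcave_of_betaPertHyp D hβ hn hβ₀ hLβ hE₂ hE₃ hsS hsmall hθc0 hθc1 hθcs hData) hB hβ

/-- **M5∕M6, THE HEADLINE v1.2 AT THE CONCAVE CONSTANT**: the type of THE HEADLINE OF RECORD
`HistoryRealiseCellsRunHeadlineT3bP.continuumYM4Torus_of_countRoadT3bP_fsc` (p224237) BY NAME — `ContinuumYM4Torus D` for
(0.4)-block-averaged `SU(N)` data from the two pins `(B)`, `BetaPertHyp`, the sign conventions, the repaired END's INHABITED
constants-only side conditions and a `CountRoadWitnessT3b` for all small-coupling tuned runs and every string — closed by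
leaf-02 gen 12's `continuumYM4Torus_of_countRoadT3bPTwin_fsc` at `Θ₀ := ΘJc d sS θc` over §3.  Same `Prop` as the record;
NE7b NOT proved; count 0∕9. [folklore] -/
example : type_of% @HistoryRealiseCellsRunHeadlineT3bP.continuumYM4Torus_of_countRoadT3bP_fsc :=
  fun D hBA hE hB hβ hsign _ _ _ _ h hμ d n hκ₁ hE₀ hA₀ hβ₀ hLβ hn₁ hn _ hθ hslack hE₂ hE₃ _ hsS hsmall _ hθc0 hθc1 hθcs
      hData =>
    continuumYM4Torus_of_countRoadT3bPTwin_fsc D hBA hE hB hβ hsign h hμ d n hκ₁ hE₀ hA₀ hβ₀ hLβ hn₁ hn hθ hslack _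
      (forSmallCouplings_twinConcave_of_betaPertHyp D hβ hn hβ₀ hLβ hE₂ hE₃ hsS hsmall hθc0 hθc1 hθcs hData)

/-- **FIDELITY AT THE TREE'S CONSTANT**: the record's apex input is ALSO an instance of the twin road at `Θ₀ := ΘJ d sS θc`
(`forSmallCouplings_twinLinear_of_betaPertHyp`) — v1.1's reading recovered through leaf-02 gen 12's uniform theorem.
[folklore] -/
example : type_of% @HistoryRealiseCellsRunHeadlineT3bP.hybridNE7Under_of_countRoadT3bP_fsc.{u} :=
  fun D hM hsign _ _ _ _ h hμ d n hκ₁ hE₀ hA₀ hβ₀ hLβ hn₁ hn _ hθ hslack hE₂ hE₃ _ hsS hsmall _ hθc0 hθc1 hθcs hData hB hβ =>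
    hybridNE7Under_of_countRoadT3bPTwin_fsc D hM hsign h hμ d n hκ₁ hE₀ hA₀ hβ₀ hLβ hn₁ hn hθ hslack _
      (forSmallCouplings_twinLinear_of_betaPertHyp D hβ hn hβ₀ hLβ hE₂ hE₃ hsS hsmall hθc0 hθc1 hθcs hData) hB hβ

end

end Summit.QuantumFields.BalabanUV.T4Continuum.HistoryRealiseCellsRunHeadlineT3bPc
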